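import Summits.AtomisticToContinuum.FouriersLaw.Theorems.BondHeatUncertaintySubdiffusiveBondHeatGibbsMomentumFourthMoment
import Summits.AtomisticToContinuum.FouriersLaw.Theorems.BondHeatUncertaintySubdiffusiveBondHeatGibbsPositionEighthMoment

/-!
# `SubdiffusiveBondHeat` / line `bath-bond-deficit-integral`: the uniform second moment of the bath-site energy

Registered sub-goal `localEnergyMoment` of crux `stmt-AtomisticToContinuum-9120` (`BondHeatUncertainty.SubdiffusiveBondHeat`):
the STATIC input of the line, `∃ σ², ∀ N ≥ 2, E_{μ_T^N}[e₀²] ≤ σ²` with `e₀ = p₀²/2 + U(q₀) + ½V(q₁ - q₀)` spelled exactly as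
the static term of `stub_bathBondReduction` — assembled from the two landed static stubs
`stub_gibbsMomentumFourthMoment` (`∫ p₀⁴ dμ_T ≤ 3T²`) and `stub_gibbsPositionEighthMoment` (`N`-uniform `∫ q₀⁸`, `∫ q₁⁸`)
through the pointwise bound `e₀² ≤ p₀⁴/2 + 2(U + V/2)² ≤ p₀⁴/2 + 2A(1 + q₀⁸ + q₁⁸)`,
`A = 4(ω₂² + lam²) + 2¹⁰(1 + β²)`. The same statics serve the sibling line `contact-kolmogorov-triad`.
-/

noncomputable section

open MeasureTheory Filter Topology Set

namespace Summit.AtomisticToContinuum.FouriersLaw.Theorems.SubdiffusiveBondHeat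

open Literature.MathematicalPhysics.KineticTheory.HeatConduction

/-- Square of a sum of four reals. -/
theorem sq_add_four_le (w x y z : ℝ) : (w + x + y + z) ^ 2 ≤ 4 * (w ^ 2 + x ^ 2 + y ^ 2 + z ^ 2) := by
  have key : 4 * (w ^ 2 + x ^ 2 + y ^ 2 + z ^ 2) - (w + x + y + z) ^ 2 =
      (w - x) ^ 2 + (w - y) ^ 2 + (w - z) ^ 2 + (x - y) ^ 2 + (x - z) ^ 2 + (y - z) ^ 2 := by ring
  have hnn : 0 ≤ (w - x) ^ 2 + (w - y) ^ 2 + (w - z) ^ 2 + (x - y) ^ 2 + (x - z) ^ 2 + (y - z) ^ 2 := by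
    positivity
  linarith

/-- `r⁴ ≤ 8a⁴ + 8b⁴` for `r = b - a`. -/
theorem sub_pow_four_le (a b : ℝ) : (b - a) ^ 4 ≤ 8 * a ^ 4 + 8 * b ^ 4 := by
  have hr2 : (b - a) ^ 2 ≤ 2 * a ^ 2 + 2 * b ^ 2 := by nlinarith [sq_nonneg (a + b)]
  have h1 : ((b - a) ^ 2) ^ 2 ≤ (2 * a ^ 2 + 2 * b ^ 2) ^ 2 := pow_le_pow_left₀ (sq_nonneg _) hr2 2
  have e1 : (b - a) ^ 4 = ((b - a) ^ 2) ^ 2 := by ring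
  have e2 : (2 * a ^ 2 + 2 * b ^ 2) ^ 2 = 8 * a ^ 4 + 8 * b ^ 4 - 4 * (a ^ 2 - b ^ 2) ^ 2 := by ring
  have h3 : 0 ≤ (a ^ 2 - b ^ 2) ^ 2 := sq_nonneg _
  rw [e1]; rw [e2] at h1; linarith

/-- `r⁸ ≤ 128a⁸ + 128b⁸` for `r = b - a`. -/
theorem sub_pow_eight_le (a b : ℝ) : (b - a) ^ 8 ≤ 128 * a ^ 8 + 128 * b ^ 8 := by
  have hr4 := sub_pow_four_le a b
  have hr4n : 0 ≤ (b - a) ^ 4 := by positivity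
  have h1 : ((b - a) ^ 4) ^ 2 ≤ (8 * a ^ 4 + 8 * b ^ 4) ^ 2 := pow_le_pow_left₀ hr4n hr4 2
  have e1 : (b - a) ^ 8 = ((b - a) ^ 4) ^ 2 := by ring
  have e2 : (8 * a ^ 4 + 8 * b ^ 4) ^ 2 = 128 * a ^ 8 + 128 * b ^ 8 - 64 * (a ^ 4 - b ^ 4) ^ 2 := by ring
  have h3 : 0 ≤ (a ^ 4 - b ^ 4) ^ 2 := sq_nonneg _
  rw [e1]; rw [e2] at h1; linarith

/-- `a⁴ ≤ 1 + a⁸`. -/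
theorem pow_four_le_one_add_pow_eight (a : ℝ) : a ^ 4 ≤ 1 + a ^ 8 := by
  have h : 0 ≤ (a ^ 4 - 1) ^ 2 := sq_nonneg _
  have e : (a ^ 4 - 1) ^ 2 = a ^ 8 - 2 * a ^ 4 + 1 := by ring
  have h4 : 0 ≤ a ^ 4 := by positivity
  rw [e] at h; linarith

/-- Pointwise: `(U(a) + V(b - a)/2)² ≤ A · (1 + a⁸ + b⁸)` for the pinned-chain potentials, with
`A = A(ω₂, lam, β) = 4(ω₂² + lam²) + 2¹⁰(1 + β²)` (generous). -/
theorem potentialEnergy_sq_le (ω₂ lam β γ a b : ℝ) :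
    ((pinnedChain ω₂ lam β γ).U a + (pinnedChain ω₂ lam β γ).V (b - a) / 2) ^ 2 ≤
      (4 * (ω₂ ^ 2 + lam ^ 2) + 2 ^ 10 * (1 + β ^ 2)) * (1 + a ^ 8 + b ^ 8) := by
  have hU : (pinnedChain ω₂ lam β γ).U a = ω₂ * a ^ 2 / 2 + lam * a ^ 4 / 4 := rfl
  have hV : (pinnedChain ω₂ lam β γ).V (b - a) = (b - a) ^ 2 / 2 + β * (b - a) ^ 4 / 4 := rfl
  rw [hU, hV]
  have ha8n : 0 ≤ a ^ 8 := by positivity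
  have hb8n : 0 ≤ b ^ 8 := by positivity
  have ha4 := pow_four_le_one_add_pow_eight a
  have hb4 := pow_four_le_one_add_pow_eight b
  have hr4 := sub_pow_four_le a b
  have hr8 := sub_pow_eight_le a b
  have hβ2 : 0 ≤ β ^ 2 := sq_nonneg β
  have hω2 : 0 ≤ ω₂ ^ 2 := sq_nonneg ω₂
  have hl2 : 0 ≤ lam ^ 2 := sq_nonneg lam
  -- `M = 1 + a⁸ + b⁸`
  have hM0 : 0 ≤ 1 + a ^ 8 + b ^ 8 := by positivity
  -- the four squares
  have t1 : (ω₂ * a ^ 2 / 2) ^ 2 ≤ ω₂ ^ 2 * (1 + a ^ 8 + b ^ 8) := by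
    have e : (ω₂ * a ^ 2 / 2) ^ 2 = ω₂ ^ 2 * (a ^ 4 / 4) := by ring
    rw [e]
    exact mul_le_mul_of_nonneg_left (by linarith) hω2
  have t2 : (lam * a ^ 4 / 4) ^ 2 ≤ lam ^ 2 * (1 + a ^ 8 + b ^ 8) := by
    have e : (lam * a ^ 4 / 4) ^ 2 = lam ^ 2 * (a ^ 8 / 16) := by ring
    rw [e]
    exact mul_le_mul_of_nonneg_left (by linarith) hl2
  have t3 : ((b - a) ^ 2 / 4) ^ 2 ≤ 1 + a ^ 8 + b ^ 8 := by
    have e : ((b - a) ^ 2 / 4) ^ 2 = (b - a) ^ 4 / 16 := by ring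
    rw [e]
    linarith
  have t4 : (β * (b - a) ^ 4 / 8) ^ 2 ≤ β ^ 2 * (2 * (1 + a ^ 8 + b ^ 8)) := by
    have e : (β * (b - a) ^ 4 / 8) ^ 2 = β ^ 2 * ((b - a) ^ 8 / 64) := by ring
    rw [e]
    exact mul_le_mul_of_nonneg_left (by linarith) hβ2
  have step := sq_add_four_le (ω₂ * a ^ 2 / 2) (lam * a ^ 4 / 4) ((b - a) ^ 2 / 4) (β * (b - a) ^ 4 / 8)
  have hfin : 4 * (ω₂ ^ 2 * (1 + a ^ 8 + b ^ 8) + lam ^ 2 * (1 + a ^ 8 + b ^ 8) + (1 + a ^ 8 + b ^ 8) +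
      β ^ 2 * (2 * (1 + a ^ 8 + b ^ 8))) ≤ (4 * (ω₂ ^ 2 + lam ^ 2) + 2 ^ 10 * (1 + β ^ 2)) * (1 + a ^ 8 + b ^ 8) := by
    have e : (4 * (ω₂ ^ 2 + lam ^ 2) + 2 ^ 10 * (1 + β ^ 2)) * (1 + a ^ 8 + b ^ 8) -
        4 * (ω₂ ^ 2 * (1 + a ^ 8 + b ^ 8) + lam ^ 2 * (1 + a ^ 8 + b ^ 8) + (1 + a ^ 8 + b ^ 8) +
          β ^ 2 * (2 * (1 + a ^ 8 + b ^ 8))) =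
        1020 * (1 + a ^ 8 + b ^ 8) + 1016 * (β ^ 2 * (1 + a ^ 8 + b ^ 8)) := by ring
    have h2 : 0 ≤ β ^ 2 * (1 + a ^ 8 + b ^ 8) := mul_nonneg hβ2 hM0
    linarith
  calc (ω₂ * a ^ 2 / 2 + lam * a ^ 4 / 4 + ((b - a) ^ 2 / 2 + β * (b - a) ^ 4 / 4) / 2) ^ 2
      = (ω₂ * a ^ 2 / 2 + lam * a ^ 4 / 4 + (b - a) ^ 2 / 4 + β * (b - a) ^ 4 / 8) ^ 2 := by ring
    _ ≤ 4 * ((ω₂ * a ^ 2 / 2) ^ 2 + (lam * a ^ 4 / 4) ^ 2 + ((b - a) ^ 2 / 4) ^ 2 +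
          (β * (b - a) ^ 4 / 8) ^ 2) := step
    _ ≤ 4 * (ω₂ ^ 2 * (1 + a ^ 8 + b ^ 8) + lam ^ 2 * (1 + a ^ 8 + b ^ 8) + (1 + a ^ 8 + b ^ 8) +
          β ^ 2 * (2 * (1 + a ^ 8 + b ^ 8))) := by linarith
    _ ≤ (4 * (ω₂ ^ 2 + lam ^ 2) + 2 ^ 10 * (1 + β ^ 2)) * (1 + a ^ 8 + b ^ 8) := hfin

/-- **The two static stubs compose**: `E_{μ_T^N}[e₀²] ≤ 3T²/2 + 2A(1 + 2C)` for every `N ≥ 2`. [folklore] -/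
theorem siteEnergy_sq_integral_le {ω₂ lam β γ T : ℝ} (hω : 0 < ω₂) (hl : 0 < lam) (hβ : 0 < β)
    (hT : 0 < T) {C : ℝ} {N : ℕ} (hN : 1 < N)
    (hp : Integrable (fun z : PhaseSpace N => (z.2 ⟨0, Nat.zero_lt_of_lt hN⟩) ^ 4)
        ((pinnedChain ω₂ lam β γ).gibbsMeasure N T) ∧
      ∫ z, (z.2 ⟨0, Nat.zero_lt_of_lt hN⟩) ^ 4 ∂((pinnedChain ω₂ lam β γ).gibbsMeasure N T) ≤ 3 * T ^ 2)
    (hq : Integrable (fun z : PhaseSpace N => (z.1 ⟨0, Nat.zero_lt_of_lt hN⟩) ^ 8)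
          ((pinnedChain ω₂ lam β γ).gibbsMeasure N T) ∧
        Integrable (fun z : PhaseSpace N => (z.1 ⟨1, hN⟩) ^ 8) ((pinnedChain ω₂ lam β γ).gibbsMeasure N T) ∧
        ∫ z, (z.1 ⟨0, Nat.zero_lt_of_lt hN⟩) ^ 8 ∂((pinnedChain ω₂ lam β γ).gibbsMeasure N T) ≤ C ∧
        ∫ z, (z.1 ⟨1, hN⟩) ^ 8 ∂((pinnedChain ω₂ lam β γ).gibbsMeasure N T) ≤ C) :
    ∫ z, ((z.2 ⟨0, Nat.zero_lt_of_lt hN⟩) ^ 2 / 2 + (pinnedChain ω₂ lam β γ).U (z.1 ⟨0, Nat.zero_lt_of_lt hN⟩) +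
        (pinnedChain ω₂ lam β γ).V (z.1 ⟨1, hN⟩ - z.1 ⟨0, Nat.zero_lt_of_lt hN⟩) / 2) ^ 2
      ∂((pinnedChain ω₂ lam β γ).gibbsMeasure N T) ≤
      3 * T ^ 2 / 2 + 2 * (4 * (ω₂ ^ 2 + lam ^ 2) + 2 ^ 10 * (1 + β ^ 2)) * (1 + C + C) := by
  set μ := (pinnedChain ω₂ lam β γ).gibbsMeasure N T with hμ
  haveI : IsProbabilityMeasure μ :=
    Literature.MathematicalPhysics.KineticTheory.HeatConduction.pinnedChain_isProbabilityMeasure_gibbsMeasure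
      hω hl.le hβ.le γ N hT
  set A : ℝ := 4 * (ω₂ ^ 2 + lam ^ 2) + 2 ^ 10 * (1 + β ^ 2) with hA
  have hA0 : 0 ≤ A := by positivity
  obtain ⟨hp4, hp4le⟩ := hp
  obtain ⟨hq0, hq1, hq0le, hq1le⟩ := hq
  set e : PhaseSpace N → ℝ := fun z => (z.2 ⟨0, Nat.zero_lt_of_lt hN⟩) ^ 2 / 2 +
    (pinnedChain ω₂ lam β γ).U (z.1 ⟨0, Nat.zero_lt_of_lt hN⟩) +
    (pinnedChain ω₂ lam β γ).V (z.1 ⟨1, hN⟩ - z.1 ⟨0, Nat.zero_lt_of_lt hN⟩) / 2 with he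
  set g : PhaseSpace N → ℝ := fun z =>
    (z.2 ⟨0, Nat.zero_lt_of_lt hN⟩) ^ 4 / 2 +
      2 * (A * (1 + (z.1 ⟨0, Nat.zero_lt_of_lt hN⟩) ^ 8 + (z.1 ⟨1, hN⟩) ^ 8)) with hg
  have hgi : Integrable g μ := by
    have h1 : Integrable (fun z : PhaseSpace N => (z.2 ⟨0, Nat.zero_lt_of_lt hN⟩) ^ 4 / 2) μ :=
      hp4.div_const 2
    have h2 : Integrable (fun z : PhaseSpace N =>
        2 * (A * (1 + (z.1 ⟨0, Nat.zero_lt_of_lt hN⟩) ^ 8 + (z.1 ⟨1, hN⟩) ^ 8))) μ :=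
      ((((integrable_const (1 : ℝ)).add hq0).add hq1).const_mul A).const_mul 2
    exact h1.add h2
  have hpt : ∀ z : PhaseSpace N, e z ^ 2 ≤ g z := by
    intro z
    simp only [he, hg]
    have hW := potentialEnergy_sq_le ω₂ lam β γ (z.1 ⟨0, Nat.zero_lt_of_lt hN⟩) (z.1 ⟨1, hN⟩)
    set W := (pinnedChain ω₂ lam β γ).U (z.1 ⟨0, Nat.zero_lt_of_lt hN⟩) +
      (pinnedChain ω₂ lam β γ).V (z.1 ⟨1, hN⟩ - z.1 ⟨0, Nat.zero_lt_of_lt hN⟩) / 2 with hWdef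
    set x := z.2 ⟨0, Nat.zero_lt_of_lt hN⟩ with hx
    have eq1 : x ^ 2 / 2 + (pinnedChain ω₂ lam β γ).U (z.1 ⟨0, Nat.zero_lt_of_lt hN⟩) +
        (pinnedChain ω₂ lam β γ).V (z.1 ⟨1, hN⟩ - z.1 ⟨0, Nat.zero_lt_of_lt hN⟩) / 2 = x ^ 2 / 2 + W := by
      rw [hWdef]; ring
    rw [eq1]
    have h2 : (x ^ 2 / 2 + W) ^ 2 ≤ 2 * (x ^ 2 / 2) ^ 2 + 2 * W ^ 2 := by nlinarith [sq_nonneg (x ^ 2 / 2 - W)]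
    have h3 : 2 * (x ^ 2 / 2) ^ 2 = x ^ 4 / 2 := by ring
    rw [← hA] at hW
    linarith
  have hnn : 0 ≤ᵐ[μ] fun z => e z ^ 2 := Eventually.of_forall fun z => sq_nonneg _
  have hmono : ∫ z, e z ^ 2 ∂μ ≤ ∫ z, g z ∂μ := integral_mono_of_nonneg hnn hgi (Eventually.of_forall hpt)
  have hgval : ∫ z, g z ∂μ =
      (∫ z, (z.2 ⟨0, Nat.zero_lt_of_lt hN⟩) ^ 4 ∂μ) / 2 +
        2 * (A * (1 + ∫ z, (z.1 ⟨0, Nat.zero_lt_of_lt hN⟩) ^ 8 ∂μ + ∫ z, (z.1 ⟨1, hN⟩) ^ 8 ∂μ)) := by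
    have h1 : Integrable (fun z : PhaseSpace N => (z.2 ⟨0, Nat.zero_lt_of_lt hN⟩) ^ 4 / 2) μ :=
      hp4.div_const 2
    have h01 : Integrable (fun z : PhaseSpace N => (1 : ℝ) + (z.1 ⟨0, Nat.zero_lt_of_lt hN⟩) ^ 8) μ :=
      (integrable_const (1 : ℝ)).add hq0
    have h012 : Integrable (fun z : PhaseSpace N =>
        (1 : ℝ) + (z.1 ⟨0, Nat.zero_lt_of_lt hN⟩) ^ 8 + (z.1 ⟨1, hN⟩) ^ 8) μ := h01.add hq1
    have h2 : Integrable (fun z : PhaseSpace N =>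
        2 * (A * (1 + (z.1 ⟨0, Nat.zero_lt_of_lt hN⟩) ^ 8 + (z.1 ⟨1, hN⟩) ^ 8))) μ :=
      (h012.const_mul A).const_mul 2
    rw [hg, integral_add h1 h2, integral_const_mul, integral_const_mul, integral_add h01 hq1,
      integral_add (integrable_const _) hq0, integral_const, integral_div]
    simp
  rw [hgval] at hmono
  have hb1 : (∫ z, (z.2 ⟨0, Nat.zero_lt_of_lt hN⟩) ^ 4 ∂μ) / 2 ≤ 3 * T ^ 2 / 2 := by linarith
  have hb2 : A * (1 + ∫ z, (z.1 ⟨0, Nat.zero_lt_of_lt hN⟩) ^ 8 ∂μ + ∫ z, (z.1 ⟨1, hN⟩) ^ 8 ∂μ) ≤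
      A * (1 + C + C) := mul_le_mul_of_nonneg_left (by linarith) hA0
  show ∫ z, e z ^ 2 ∂μ ≤ _
  linarith

/-- **Registered sub-goal `localEnergyMoment`** of crux stmt-AtomisticToContinuum-9120 (line `bath-bond-deficit-integral`): the
`N`-uniform second moment of the bath-site energy, `∃ σ², ∀ N ≥ 2, ∫ e₀² dμ_T^N ≤ σ²`, from the two landed static stubs.
[folklore] -/
theorem localEnergyMoment :
    ∀ ω₂ lam β γ : ℝ, 0 < ω₂ → 0 < lam → 0 < β → 0 < γ → ∀ T : ℝ, 0 < T → ∃ σ2 : ℝ, ∀ (N : ℕ) (hN : 1 < N), ∫ z, ((z.2 ⟨0, Nat.zero_lt_of_lt hN⟩) ^ 2 / 2 + (pinnedChain ω₂ lam β γ).U (z.1 ⟨0, Nat.zero_lt_of_lt hN⟩) + (pinnedChain ω₂ lam β γ).V (z.1 ⟨1, hN⟩ - z.1 ⟨0, Nat.zero_lt_of_lt hN⟩) / 2) ^ 2 ∂((pinnedChain ω₂ lam β γ).gibbsMeasure N T) ≤ σ2 := by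
  intro ω₂ lam β γ hω hl hβ hγ T hT
  obtain ⟨C, hC⟩ := stub_gibbsPositionEighthMoment ω₂ lam β γ hω hl hβ hγ T hT
  refine ⟨3 * T ^ 2 / 2 + 2 * (4 * (ω₂ ^ 2 + lam ^ 2) + 2 ^ 10 * (1 + β ^ 2)) * (1 + C + C), fun N hN => ?_⟩
  exact siteEnergy_sq_integral_le hω hl hβ hT hN
    (stub_gibbsMomentumFourthMoment ω₂ lam β γ hω hl hβ hγ T hT N (Nat.zero_lt_of_lt hN)) (hC N hN)

end Summit.AtomisticToContinuum.FouriersLaw.Theorems.SubdiffusiveBondHeat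

end
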